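import Summits.AtomisticToContinuum.BoseEinsteinCondensation.Theorems.BECRieszReverseHolderCoarseGrainedReverseHolderStubRieszKernelOnsagerBound
import Summits.AtomisticToContinuum.BoseEinsteinCondensation.Theorems.BECRieszReverseHolderCoarseGrainedReverseHolderStubRieszFieldMomentPinned
import Summits.AtomisticToContinuum.BoseEinsteinCondensation.Theorems.BECRieszReverseHolderShadowCavityField
import Literature.MathematicalPhysics.StatisticalMechanics.PeriodicRieszKernelSelfEnergy

/-!
# `RieszShadowFieldMoment` for `θ ∈ [0, 1]` (route BECRieszReverseHolder, crux CoarseGrainedReverseHolder)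

Line `registered` of crux stmt-AtomisticToContinuum-12840; registered sub-goal
`stub_rieszShadowFieldMoment_thetaLeOne` of the stub `stub_rieszShadowFieldMoment` (= route item
stmt-AtomisticToContinuum-12841 `RieszShadowFieldMoment`, which asks the same bound for `θ ∈ [0, 4]`).

For the smeared, zero-mean, `Lℤ³`-periodic Riesz-2 kernel `g = periodicRieszKernel 2 L η` (the kernel
inlined in the item, `CoarseRH2.periodicRieszKernel_two_eq`), `H = Σ_{i<j} g(X_i - X_j)` and the
cavity field `h_X(y) = Σ_j g(y - X_j)`, we prove the item's statement VERBATIM except `θ ≤ 1` in place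
of `θ ≤ 4`, with `C = 2` and `Γ₀ = 1/(2C₂)` (`C₂` the uniform self-energy constant `g(0) ≤ C₂ η⁻²` of
`exists_periodicRieszKernel_zero_le`):

* `θ = 1` is the pinned-particle engine `stub_rieszFieldMomentPinned` with `u = b·g` (Onsager's bound
  `stub_rieszKernelOnsagerBound`): `(1 - b g(0)) ∫ e^{-bH - b h_y} ≤ ∫ e^{-bH}` for every `n, L, y`;
* `θ ∈ [0, 1]` by convexity, `e^{-θ b h} ≤ (1 - θ) + θ e^{-b h}` (`RieszFieldMoment.pinned_theta_le`);
* the Kac corner `ρη³ ≥ 1` and `bρ^{2/3} ≤ Γ₀` (`ρ = n/L³`) give `b g(0) ≤ C₂ b η⁻² ≤ C₂ bρ^{2/3} ≤ 1/2`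
  (`RieszFieldMoment.corner`).

## The wall for `θ ∈ (1, 4]`

By convexity of `θ ↦ log ∫ e^{-bH - θ b h_y}` and the same `e^x ≥ 1 + x` step, the item for `θ ≤ 4`
follows from the *impurity mean-field bound*: for `m = 2, 3, 4`,
`b ∫ h_X(y) e^{-bH(X) - m b h_X(y)} dX ≥ -c ∫ e^{-bH(X) - m b h_X(y)} dX` with `c < 1` uniform in the
corner (the mean cavity field at a charge-`m` impurity is `≥ -c/b`). For `m = 1` this is the symmetry
inequality of the engine (`c = b g(0)`); for `m ≥ 2` the impurity is distinguishable, relabelling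
symmetry is lost, and the bound is a one-point local law for the high-temperature (`bρ^{2/3} ≪ 1`),
long-range (`∫_cell |g| ~ L`) periodic Riesz-2 gas — not in the tree and not in print for this regime.
-/

namespace Summit.AtomisticToContinuum.BoseEinsteinCondensation.Theorems.CoarseGrainedReverseHolder

open Summit.AtomisticToContinuum.BoseEinsteinCondensation.Theses.BECRieszReverseHolder
open MeasureTheory Real UnitAddTorus
open Literature.MathematicalPhysics.StatisticalMechanics Literature.Analysis.UnboundedOperators
open Literature.Analysis.FunctionSpaces
open Literature.MathematicalPhysics.QuantumManyBody BoseGas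

namespace RieszFieldMoment

variable {n : ℕ} {L : ℝ}

/-- Convexity of the exponential: `e^{θx} ≤ (1 - θ) + θ e^x` for `θ ∈ [0,1]`. -/
theorem exp_mul_le_of_mem_unitInterval {θ : ℝ} (h0 : 0 ≤ θ) (h1 : θ ≤ 1) (x : ℝ) :
    Real.exp (θ * x) ≤ (1 - θ) + θ * Real.exp x := by
  have h := convexOn_exp.2 (Set.mem_univ (0 : ℝ)) (Set.mem_univ x) (sub_nonneg.2 h1) h0
    (by ring)
  simpa only [smul_eq_mul, mul_zero, zero_add, Real.exp_zero, mul_one] using h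

/-- **The field moment for `θ ∈ [0,1]`**, real form: with `u(0) ≤ 1/2`,
`∫ e^{-E - θ h_y} ≤ 2 ∫ e^{-E}`. -/
theorem pinned_theta_le (hL : 0 < L) (u : Space → ℝ) (hu : Continuous u) (heven : ∀ z, u (-z) = u z)
    (hper : ∀ (z : Space) (k : Fin 3), u (z + EuclideanSpace.single k L) = u z)
    (hons : ∀ (N : ℕ) (X : Config N), -((N : ℝ) * u 0 / 2) ≤
      ∑ i : Fin N, ∑ j : Fin N with i < j, u (X i - X j))
    (hu0 : u 0 ≤ 1 / 2) {θ : ℝ} (hθ0 : 0 ≤ θ) (hθ1 : θ ≤ 1) (y : Space) :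
    ∫ X in cellN n L, Real.exp (-(∑ a : Fin n, ∑ c : Fin n with a < c, u (X a - X c)) -
        θ * ∑ j : Fin n, u (y - X j)) ≤
      2 * ∫ X in cellN n L, Real.exp (-(∑ a : Fin n, ∑ c : Fin n with a < c, u (X a - X c))) := by
  set Z : ℝ := ∫ X in cellN n L, Real.exp (-(∑ a : Fin n, ∑ c : Fin n with a < c, u (X a - X c))) with hZ
  set D : ℝ := ∫ X in cellN n L,
    Real.exp (-(∑ a : Fin n, ∑ c : Fin n with a < c, u (X a - X c)) - ∑ j : Fin n, u (y - X j)) with hD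
  have hEc : Continuous fun X : Config n => ∑ a : Fin n, ∑ c : Fin n with a < c, u (X a - X c) :=
    continuous_finsetSum _ fun a _ => continuous_finsetSum _ fun c _ =>
      hu.comp ((continuous_apply a).sub (continuous_apply c))
  have hhc : Continuous fun X : Config n => ∑ j : Fin n, u (y - X j) :=
    continuous_finsetSum _ fun j _ => hu.comp (continuous_const.sub (continuous_apply j))
  have hZc : Continuous fun X : Config n =>
      Real.exp (-(∑ a : Fin n, ∑ c : Fin n with a < c, u (X a - X c))) := Real.continuous_exp.comp hEc.neg
  have hDc : Continuous fun X : Config n => Real.exp (-(∑ a : Fin n, ∑ c : Fin n with a < c,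
      u (X a - X c)) - ∑ j : Fin n, u (y - X j)) := Real.continuous_exp.comp (hEc.neg.sub hhc)
  have hθc : Continuous fun X : Config n => Real.exp (-(∑ a : Fin n, ∑ c : Fin n with a < c,
      u (X a - X c)) - θ * ∑ j : Fin n, u (y - X j)) :=
    Real.continuous_exp.comp (hEc.neg.sub (continuous_const.mul hhc))
  have hZ0 : 0 ≤ Z := setIntegral_nonneg (measurableSet_cellN n L) fun X _ => (Real.exp_pos _).le
  have hD1 : (1 - u 0) * D ≤ Z := pinned_le hL u hu heven hper hons y
  have hD0 : 0 ≤ D := setIntegral_nonneg (measurableSet_cellN n L) fun X _ => (Real.exp_pos _).le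
  have hDle : D ≤ 2 * Z := by nlinarith [hD1, mul_le_mul_of_nonneg_right hu0 hD0]
  -- pointwise convexity
  have hpt : ∀ X : Config n, Real.exp (-(∑ a : Fin n, ∑ c : Fin n with a < c, u (X a - X c)) -
        θ * ∑ j : Fin n, u (y - X j)) ≤
      (1 - θ) * Real.exp (-(∑ a : Fin n, ∑ c : Fin n with a < c, u (X a - X c))) +
        θ * Real.exp (-(∑ a : Fin n, ∑ c : Fin n with a < c, u (X a - X c)) - ∑ j : Fin n, u (y - X j)) := by
    intro X
    set E := ∑ a : Fin n, ∑ c : Fin n with a < c, u (X a - X c)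
    set h := ∑ j : Fin n, u (y - X j)
    have h1 := exp_mul_le_of_mem_unitInterval hθ0 hθ1 (-h)
    have h2 : Real.exp (-E - θ * h) = Real.exp (-E) * Real.exp (θ * -h) := by
      rw [← Real.exp_add]; ring_nf
    have h3 : Real.exp (-E - h) = Real.exp (-E) * Real.exp (-h) := by
      rw [← Real.exp_add]; ring_nf
    rw [h2, h3]
    nlinarith [Real.exp_pos (-E), h1]
  calc ∫ X in cellN n L, Real.exp (-(∑ a : Fin n, ∑ c : Fin n with a < c, u (X a - X c)) -
          θ * ∑ j : Fin n, u (y - X j))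
      ≤ ∫ X in cellN n L, ((1 - θ) * Real.exp (-(∑ a : Fin n, ∑ c : Fin n with a < c, u (X a - X c))) +
          θ * Real.exp (-(∑ a : Fin n, ∑ c : Fin n with a < c, u (X a - X c)) -
            ∑ j : Fin n, u (y - X j))) :=
        setIntegral_mono_on (integrableOn_cellN hθc L)
          (show IntegrableOn (fun X : Config n =>
              (1 - θ) * Real.exp (-(∑ a : Fin n, ∑ c : Fin n with a < c, u (X a - X c))) +
                θ * Real.exp (-(∑ a : Fin n, ∑ c : Fin n with a < c, u (X a - X c)) -
                  ∑ j : Fin n, u (y - X j))) (cellN n L) volume from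
            integrableOn_cellN ((continuous_const.mul hZc).add (continuous_const.mul hDc)) L)
          (measurableSet_cellN n L) fun X _ => hpt X
    _ = (1 - θ) * Z + θ * D := by
        have i1 : IntegrableOn (fun X : Config n =>
            (1 - θ) * Real.exp (-(∑ a : Fin n, ∑ c : Fin n with a < c, u (X a - X c)))) (cellN n L) volume :=
          integrableOn_cellN (continuous_const.mul hZc) L
        have i2 : IntegrableOn (fun X : Config n =>
            θ * Real.exp (-(∑ a : Fin n, ∑ c : Fin n with a < c, u (X a - X c)) - ∑ j : Fin n, u (y - X j)))
            (cellN n L) volume :=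
          integrableOn_cellN (continuous_const.mul hDc) L
        rw [integral_add i1 i2, integral_const_mul, integral_const_mul]
    _ ≤ 2 * Z := by nlinarith [hDle, hZ0, hθ0, hθ1]

/-- **The field moment for `θ ∈ [0,1]`**, `ℝ≥0∞` form. -/
theorem lintegral_pinned_theta_le (hL : 0 < L) (u : Space → ℝ) (hu : Continuous u)
    (heven : ∀ z, u (-z) = u z)
    (hper : ∀ (z : Space) (k : Fin 3), u (z + EuclideanSpace.single k L) = u z)
    (hons : ∀ (N : ℕ) (X : Config N), -((N : ℝ) * u 0 / 2) ≤
      ∑ i : Fin N, ∑ j : Fin N with i < j, u (X i - X j))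
    (hu0 : u 0 ≤ 1 / 2) {θ : ℝ} (hθ0 : 0 ≤ θ) (hθ1 : θ ≤ 1) (y : Space) :
    ∫⁻ X in cellN n L, ENNReal.ofReal (Real.exp (-(∑ a : Fin n, ∑ c : Fin n with a < c, u (X a - X c)) -
        θ * ∑ j : Fin n, u (y - X j))) ≤
      ENNReal.ofReal 2 * ∫⁻ X in cellN n L,
        ENNReal.ofReal (Real.exp (-(∑ a : Fin n, ∑ c : Fin n with a < c, u (X a - X c)))) := by
  have hEc : Continuous fun X : Config n => ∑ a : Fin n, ∑ c : Fin n with a < c, u (X a - X c) :=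
    continuous_finsetSum _ fun a _ => continuous_finsetSum _ fun c _ =>
      hu.comp ((continuous_apply a).sub (continuous_apply c))
  have hhc : Continuous fun X : Config n => ∑ j : Fin n, u (y - X j) :=
    continuous_finsetSum _ fun j _ => hu.comp (continuous_const.sub (continuous_apply j))
  have hZc : Continuous fun X : Config n =>
      Real.exp (-(∑ a : Fin n, ∑ c : Fin n with a < c, u (X a - X c))) := Real.continuous_exp.comp hEc.neg
  have hθc : Continuous fun X : Config n => Real.exp (-(∑ a : Fin n, ∑ c : Fin n with a < c,
      u (X a - X c)) - θ * ∑ j : Fin n, u (y - X j)) :=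
    Real.continuous_exp.comp (hEc.neg.sub (continuous_const.mul hhc))
  rw [← ofReal_integral_eq_lintegral_ofReal (integrableOn_cellN hθc L)
      (Filter.Eventually.of_forall fun X => (Real.exp_pos _).le),
    ← ofReal_integral_eq_lintegral_ofReal (integrableOn_cellN hZc L)
      (Filter.Eventually.of_forall fun X => (Real.exp_pos _).le),
    ← ENNReal.ofReal_mul (by norm_num)]
  exact ENNReal.ofReal_le_ofReal (pinned_theta_le hL u hu heven hper hons hu0 hθ0 hθ1 y)


/-! ### The corner: `b g(0) ≤ 1/2` -/

/-- **Kac corner + weak coupling ⇒ small self-energy**: with `C₂` the uniform self-energy constant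
(`g(0) ≤ C₂ η⁻²`) and `Γ₀ = 1/(2C₂)`, the hypotheses `ρη³ ≥ 1`, `bρ^{2/3} ≤ Γ₀` (`ρ = n/L³`) give
`b g(0) ≤ 1/2`. -/
theorem corner : ∃ Γ₀ : ℝ, 0 < Γ₀ ∧ ∀ (n : ℕ) (L b η : ℝ), 0 < L → 0 < b → 0 < η →
    (1 : ℝ) ≤ (n : ℝ) / L ^ 3 * η ^ 3 → b * ((n : ℝ) / L ^ 3) ^ (2 / 3 : ℝ) ≤ Γ₀ →
    b * periodicRieszKernel 2 L η 0 ≤ 1 / 2 := by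
  obtain ⟨C, hC, hbound⟩ := exists_periodicRieszKernel_zero_le (s := 2) two_pos
  refine ⟨1 / (2 * C), by positivity, fun n L b η hL hb hη hkac hΓ => ?_⟩
  set ρ : ℝ := (n : ℝ) / L ^ 3 with hρ
  have hη3 : 0 < η ^ 3 := by positivity
  have hρpos : 0 < ρ := by
    by_contra h
    have : ρ * η ^ 3 ≤ 0 := mul_nonpos_of_nonpos_of_nonneg (not_lt.mp h) hη3.le
    linarith
  -- η⁻² ≤ ρ^{2/3}
  have h1 : (η ^ 3)⁻¹ ≤ ρ := by
    rw [inv_le_iff_one_le_mul₀ hη3]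
    linarith [mul_comm ρ (η ^ 3)]
  have h2 : η ^ (-(2 : ℝ)) ≤ ρ ^ (2 / 3 : ℝ) := by
    have h3 : η ^ (-(2 : ℝ)) = ((η ^ 3)⁻¹) ^ (2 / 3 : ℝ) := by
      rw [show ((η ^ 3)⁻¹ : ℝ) = η ^ (-(3 : ℝ)) by
        rw [Real.rpow_neg hη.le, show (3 : ℝ) = ((3 : ℕ) : ℝ) by norm_num, Real.rpow_natCast],
        ← Real.rpow_mul hη.le]
      norm_num
    rw [h3]
    exact Real.rpow_le_rpow (inv_nonneg.2 hη3.le) h1 (by norm_num)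
  have hg0 := (hbound L η hL hη).2
  calc b * periodicRieszKernel 2 L η 0 ≤ b * (C * η ^ (-(2 : ℝ))) :=
        mul_le_mul_of_nonneg_left hg0 hb.le
    _ = C * (b * η ^ (-(2 : ℝ))) := by ring
    _ ≤ C * (b * ρ ^ (2 / 3 : ℝ)) := by gcongr
    _ ≤ C * (1 / (2 * C)) := by gcongr
    _ = 1 / 2 := by field_simp

end RieszFieldMoment

/-! ## The registered sub-goal: `RieszShadowFieldMoment` with `θ ≤ 1` -/

/-- **`RieszShadowFieldMoment` for `θ ∈ [0, 1]`** (route item stmt-AtomisticToContinuum-12841 with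
`θ ≤ 1` in place of `θ ≤ 4`; `C = 2`, `Γ₀ = 1/(2C₂)`): uniform exponential moments
`∫_{cell^n} e^{-bH} e^{-θ b h_X(y)} dX ≤ 2 ∫_{cell^n} e^{-bH} dX` of the cavity field of the weakly
coupled smeared periodic Riesz-2 gas, for every `n`, `L`, `y`, in the Kac corner. -/
theorem stub_rieszShadowFieldMoment_thetaLeOne : ∃ Γ₀ : ℝ, 0 < Γ₀ ∧ ∃ C : ℝ, ∀ (n : ℕ) (L b η θ : ℝ), 0 < L → 0 < b → 0 < η → η ≤ L → 0 ≤ θ → θ ≤ 1 → (1 : ℝ) ≤ (n : ℝ) / L ^ 3 * η ^ 3 → b * ((n : ℝ) / L ^ 3) ^ (2 / 3 : ℝ) ≤ Γ₀ → ∀ g : BoseGas.Space → ℝ, g = (fun x => 2 * Real.pi ^ (3 / 2 : ℝ) * ∫ t in Set.Ioi (η ^ 2), t ^ (-(1 / 2 : ℝ)) * ((∑' m : Fin 3 → ℤ, Literature.Analysis.UnboundedOperators.heatKernel t (x - BoseGas.latticeVec L m)) - 1 / L ^ 3)) → ∀ H : BoseGas.Config n → ℝ, H = (fun X => ∑ i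 : Fin n, ∑ j : Fin n with i < j, g (X i - X j)) → ∀ y : BoseGas.Space, ∫⁻ X in BoseGas.cellN n L, ENNReal.ofReal (Real.exp (-(b * H X) - θ * b * ∑ j : Fin n, g (y - X j))) ≤ ENNReal.ofReal C * ∫⁻ X in BoseGas.cellN n L, ENNReal.ofReal (Real.exp (-(b * H X))) := by
  obtain ⟨Γ₀, hΓ₀, hcorner⟩ := RieszFieldMoment.corner
  refine ⟨Γ₀, hΓ₀, 2, ?_⟩
  intro n L b η θ hL hb hη _hηL hθ0 hθ1 hkac hΓ g hg H hH y
  have hg' : g = periodicRieszKernel 2 L η := by rw [hg, CoarseRH2.periodicRieszKernel_two_eq]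
  subst hH
  have hηne : η ≠ 0 := hη.ne'
  set u : Space → ℝ := fun z => b * g z with hu_def
  have hu : Continuous u := by
    rw [hu_def, hg']
    exact continuous_const.mul (continuous_periodicRieszKernel 2 hL hηne)
  have heven : ∀ z, u (-z) = u z := fun z => by
    simp only [hu_def, hg', periodicRieszKernel_neg]
  have hper : ∀ (z : Space) (k : Fin 3), u (z + EuclideanSpace.single k L) = u z := fun z k => by
    simp only [hu_def, hg', periodicRieszKernel_add_single]
  have hons : ∀ (N : ℕ) (X : Config N), -((N : ℝ) * u 0 / 2) ≤
      ∑ i : Fin N, ∑ j : Fin N with i < j, u (X i - X j) := by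
    intro N X
    have h := mul_le_mul_of_nonneg_left
      (stub_rieszKernelOnsagerBound 2 L η two_pos hL hηne N X) hb.le
    rw [Finset.mul_sum] at h
    simp only [Finset.mul_sum] at h
    simp only [hu_def, hg']
    linarith
  have hu0 : u 0 ≤ 1 / 2 := by
    simp only [hu_def, hg']
    exact hcorner n L b η hL hb hη hkac hΓ
  have key := RieszFieldMoment.lintegral_pinned_theta_le (n := n) hL u hu heven hper hons hu0 hθ0 hθ1 y
  have e1 : ∀ X : Config n, -(b * ∑ i : Fin n, ∑ j : Fin n with i < j, g (X i - X j)) -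
      θ * b * ∑ j : Fin n, g (y - X j) =
      -(∑ i : Fin n, ∑ j : Fin n with i < j, u (X i - X j)) - θ * ∑ j : Fin n, u (y - X j) := by
    intro X
    simp only [hu_def, Finset.mul_sum]
    ring
  have e2 : ∀ X : Config n, -(b * ∑ i : Fin n, ∑ j : Fin n with i < j, g (X i - X j)) =
      -(∑ i : Fin n, ∑ j : Fin n with i < j, u (X i - X j)) := by
    intro X
    simp only [hu_def, Finset.mul_sum]
  simp_rw [e1, e2]
  exact key

end Summit.AtomisticToContinuum.BoseEinsteinCondensation.Theorems.CoarseGrainedReverseHolder
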